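import Summits.QuantumFields.YangMills.Theorems.LuscherReductionTwistedTraceScalingBOStiffCentralWeight
import Summits.QuantumFields.YangMills.Theorems.LuscherReductionTwistedTraceScalingBOStiffCoreMass
import Summits.QuantumFields.YangMills.Theorems.LuscherReductionTwistedTraceScalingBOMassRatioSharp
import Summits.QuantumFields.YangMills.Theorems.LuscherReductionTwistedTraceScalingBOStiffWeightTransport
import HarnessLib

/-!
# (B-ST) (W1-10b) `…BOStiffRing`: the (ring) clause of the model atom of (A) — the mass of `cΘ²cW` outside the inner twelfth of the profile ball is `o(1)` of the total
# (lane A of S-BASE, crux `TwistedTraceScaling` stmt-QuantumFields-20203, C4-CORE, the (B-ST) pen; HANDOFF-g21 UPDATE 21:01Z (W1-10) = (A), ✓`…BOStiffQuasimodeFrame`)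

With the inner set `I(β) = cS β ∩ {‖x̂‖ ≤ r_f(β)/12}`:
* `mem_cS_iff` — `cS β = Bal_cap ∩ {‖x̂‖ ≤ r_f(β)}` (the frozen profile is a closed-ball indicator times positive Gaussians);
* ★★ `eventually_ring_mass_le` — `∃ M₀ ≥ 2, ∀ M ≥ M₀, ∀ σ > 0, ∀ᶠ β, ∫_{cS∖I} cΘ²·cW dπ ≤ σ·∫ cΘ²·cW dπ`.
Mechanism: on `cS`, `cΘ²cW = N(oT 1 x)·e^{−‖P_Γx̂‖²β²}·e^{−2q(x̂)}` (✓`cΘ_sq_mul_cW_eq`) with `N ∈ N̄(1±κ)` (✓`fpWeight_record_sandwich`, `κ → 0`), and the Gaussian mass of the shell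
`r_f/12 < ‖x̂‖ ≤ r_f` is `≤ a·`(inner mass) for every `a > 0` eventually (✓`…BOMassRatioSharp.massRatio_le_one_add`, coercivity of `β²‖P_Γ·‖² + 2q` ⟸ the lattice Hodge lemma).
HONEST FRAMING: bookkeeping for a stub of a child of the CONDITIONAL route R2b1; (Q±) of the atom OPEN; (B-ST), C4-CORE OPEN; not infinite volume, not a gap, not Clay.
-/

set_option autoImplicit false

noncomputable section

open MeasureTheory Filter Topology Real
open scoped BigOperators
open Literature.MathematicalPhysics.QuantumFieldTheory
open Literature.MathematicalPhysics.QuantumLattice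

namespace Summit.QuantumFields.YangMills.Theorems.FemtoTransferGap.TwoLattice.ConstTube

open Summit.QuantumFields.YangMills.Theorems.FemtoTransferGap
open Summit.QuantumFields.YangMills.Theorems.FemtoTransferGap.TwoLattice
open Summit.QuantumFields.YangMills.Theorems.FemtoTransferGap.TwoLattice.Avg
open Summit.QuantumFields.YangMills.Theorems.FemtoTransferGap.TwoLattice.Stiff (LinkSpace)
open Summit.QuantumFields.YangMills.Theorems.FemtoTransferGap.TwoLattice.GnChart

variable {L : ℕ} [NeZero L]

/-! ## §1 The support of the central profile -/

/-- `cS β = Bal_cap ∩ {‖x̂‖ ≤ r_f(β)}`. [folklore] -/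
theorem mem_cS_iff (β : ℝ) (x : Edge 3 L → Fin 3 → ℝ) :
    x ∈ cS L β ↔ x ∈ capBalancedSet L ∧ ‖linkEmbed L x‖ ≤ min (1 / 40) (powScale (1 / 2) β * btLog β) := by
  constructor
  · exact fun hx => mem_cS hx
  · rintro ⟨hcap, hr⟩
    show cΘ L β x ≠ 0
    unfold cΘ cΩ
    have hmem : linkEmbed L x ∈ {y : LinkSpace L | linkCurry y ∈ capBalancedSet L} := by
      show linkCurry (linkEmbed L x) ∈ capBalancedSet L
      have e : linkCurry (linkEmbed L x) = x := by funext e a; rfl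
      rw [e]; exact hcap
    rw [Set.indicator_of_mem hmem, one_mul]
    unfold frozenProfile
    rw [Set.indicator_of_mem (by simpa [Metric.mem_closedBall, dist_zero_right] using hr), mul_one]
    exact mul_ne_zero (Real.exp_pos _).ne' (Real.exp_pos _).ne'

/-! ## §2 ★★ The ring mass -/

set_option maxHeartbeats 1600000 in
-- long record expressions.
/-- ★★ **RING MASS**: `∃ M₀ ≥ 2, ∀ M ≥ M₀, ∀ σ > 0, ∀ᶠ β, ∫_{cS β ∖ I(β)} cΘ²cW dπ ≤ σ·∫ cΘ²cW dπ`, `I(β) = cS β ∩ {‖x̂‖ ≤ r_f(β)/12}`. [cite: Luscher1983, §3] -/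
theorem eventually_ring_mass_le (hLz : Nonempty (NzSite L)) (hL : 2 ≤ L) {s : ℝ} (hs : 0 < s) (hs3 : s ≤ 1 / 3) :
    ∃ M₀ : ℝ, 2 ≤ M₀ ∧ ∀ M : ℝ, M₀ ≤ M → ∀ σ : ℝ, 0 < σ → ∀ᶠ β : ℝ in atTop,
      ∫ x in cS L β \ (cS L β ∩ {x | ‖linkEmbed L x‖ ≤ min (1 / 40) (powScale (1 / 2) β * btLog β) / 12}), cΘ L β x ^ 2 * cW L s M β x ∂orthoTransverse L ≤
        σ * ∫ x, cΘ L β x ^ 2 * cW L s M β x ∂orthoTransverse L := by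
  haveI := isFiniteMeasure_orthoTransverse L
  obtain ⟨M₀, hM₀, H⟩ := fpWeight_record_sandwich (L := L) hLz hs hs3
  refine ⟨M₀, hM₀, fun M hM σ hσ => ?_⟩
  obtain ⟨C, β₀, hC, hP⟩ := H M hM
  have hM2 : 2 ≤ M := hM₀.trans hM
  have hδ : Tendsto (fun β => 43 * powScale s β) atTop (𝓝 0) := by simpa using (tendsto_powScale hs).const_mul 43
  have hδ2 : Tendsto (fun β => (43 * powScale s β) ^ 2) atTop (𝓝 0) := by simpa using hδ.pow 2
  have ha : 0 < σ / 3 := by positivity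
  filter_upwards [eventually_ge_atTop β₀, eventually_mul_le_of_tendsto hδ2 C (by norm_num : (0 : ℝ) < 1 / 2),
    eventually_orthoTube_one_mem_fatTube_of_norm_le (L := L) hs (by linarith) hM2, massRatio_le_one_add (L := L) hL ha, eventually_ge_atTop (0 : ℝ)]
    with β hβ₀ hκ hcore hratio hβ0
  -- names
  set rf : ℝ := min (1 / 40) (powScale (1 / 2) β * btLog β) with hrf
  set Nbar : ℝ := fpWeightBar L (powScale 1 β) with hNbar
  set κ : ℝ := C * (43 * powScale s β) ^ 2 with hκdef
  have hκ0 : 0 ≤ κ := by positivity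
  have hN0 : 0 < Nbar := fpWeightBar_pos L (powScale_pos 1 β)
  set f : (Edge 3 L → Fin 3 → ℝ) → ℝ := fun v => Real.exp (-(stiffGaussExp L (β / 2) β (linkEmbed L v))) ^ 2 *
    Real.exp (-(‖(gaugeModes L).starProjection (linkEmbed L v)‖ ^ 2 / powScale 1 β ^ 2)) with hfdef
  have hf0 : ∀ v, 0 ≤ f v := fun v => by positivity
  have hf1 : ∀ v, f v ≤ 1 := fun v => by
    have h1 : Real.exp (-(stiffGaussExp L (β / 2) β (linkEmbed L v))) ≤ 1 := Real.exp_le_one_iff.mpr (neg_nonpos.mpr (stiffGaussExp_nonneg _ _ _))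
    have h2 : Real.exp (-(‖(gaugeModes L).starProjection (linkEmbed L v)‖ ^ 2 / powScale 1 β ^ 2)) ≤ 1 := Real.exp_le_one_iff.mpr (neg_nonpos.mpr (by positivity))
    calc f v ≤ 1 ^ 2 * 1 := mul_le_mul (pow_le_pow_left₀ (Real.exp_pos _).le h1 2) h2 (Real.exp_pos _).le (by positivity)
      _ = 1 := by norm_num
  have hfm : Measurable f := by
    have h1 : Measurable fun v : Edge 3 L → Fin 3 → ℝ => stiffGaussExp L (β / 2) β (linkEmbed L v) := (measurable_stiffGaussExp _ _).comp (measurable_linkEmbed (L := L))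
    have h2 : Measurable fun v : Edge 3 L → Fin 3 → ℝ => ‖(gaugeModes L).starProjection (linkEmbed L v)‖ :=
      ((gaugeModes L).starProjection.continuous.measurable.comp (measurable_linkEmbed (L := L))).norm
    exact ((Real.measurable_exp.comp h1.neg).pow_const 2).mul (Real.measurable_exp.comp ((h2.pow_const 2).div_const _).neg)
  set A : ℝ := ∫ v, {v : Edge 3 L → Fin 3 → ℝ | ‖linkEmbed L v‖ ≤ rf}.indicator (fun _ => (1 : ℝ)) v * f v ∂orthoTransverse L with hAdef
  set B : ℝ := ∫ v, {v : Edge 3 L → Fin 3 → ℝ | ‖linkEmbed L v‖ ≤ rf / 12}.indicator (fun _ => (1 : ℝ)) v * f v ∂orthoTransverse L with hBdef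
  have hAB : A ≤ (1 + σ / 3) * B := hratio
  -- the density identity on `cS`
  obtain ⟨-, -, -, -, hΘm, hΘ1, hΘ0, hΘS, hSm⟩ := central_kform_data (L := L) hβ0
  obtain ⟨hwm, hwb, hw0⟩ := cW_props (L := L) s M β
  have hdens : ∀ x ∈ cS L β, cΘ L β x ^ 2 * cW L s M β x = gaugeAvg (recordChi L s 43 M β) (orthoTube L 1 x) * f x := fun x hx => by
    have hF := hcore x (mem_cS hx).2
    rw [cΘ_sq_mul_cW_eq s M β hx hF, hfdef]
    simp only
    rw [← Real.exp_nat_mul]; push_cast; ring_nf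
  have hNup : ∀ x ∈ cS L β, gaugeAvg (recordChi L s 43 M β) (orthoTube L 1 x) ≤ Nbar * (1 + κ) := fun x hx => (hP β hβ₀ _ (hcore x (mem_cS hx).2)).2
  have hNlo : ∀ x ∈ cS L β, Nbar * (1 - κ) ≤ gaugeAvg (recordChi L s 43 M β) (orthoTube L 1 x) := fun x hx => (hP β hβ₀ _ (hcore x (mem_cS hx).2)).1
  -- measurable sets
  have hBall : ∀ R : ℝ, MeasurableSet {v : Edge 3 L → Fin 3 → ℝ | ‖linkEmbed L v‖ ≤ R} := fun R =>
    measurableSet_le (measurable_linkEmbed (L := L)).norm measurable_const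
  set I : Set (Edge 3 L → Fin 3 → ℝ) := cS L β ∩ {x | ‖linkEmbed L x‖ ≤ rf / 12} with hIdef
  have hIm : MeasurableSet I := hSm.inter (hBall _)
  -- integrability of `cΘ²cW`
  have hgm : Measurable fun x => cΘ L β x ^ 2 * cW L s M β x := (hΘm.pow_const 2).mul hwm
  have hgi : Integrable (fun x => cΘ L β x ^ 2 * cW L s M β x) (orthoTransverse L) :=
    integrable_of_measurable_abs_le _ hgm (C := 1 * Real.exp ((Fintype.card (Edge 3 L) : ℝ) / powScale 1 β ^ 2)) fun x => by
      rw [abs_mul, abs_pow]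
      exact mul_le_mul (by rw [← one_pow 2]; exact pow_le_pow_left₀ (abs_nonneg _) (hΘ1 x) 2) (hwb x) (abs_nonneg _) zero_le_one
  have hg0 : ∀ x, 0 ≤ cΘ L β x ^ 2 * cW L s M β x := fun x => mul_nonneg (sq_nonneg _) (hw0 x)
  have hind_i : ∀ R : ℝ, Integrable (fun v => {v : Edge 3 L → Fin 3 → ℝ | ‖linkEmbed L v‖ ≤ R}.indicator (fun _ => (1 : ℝ)) v * f v) (orthoTransverse L) := fun R =>
    integrable_of_measurable_abs_le _ ((measurable_const.indicator (hBall R)).mul hfm) (C := 1) fun v => by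
      rw [abs_mul, abs_of_nonneg (hf0 v)]
      by_cases hv : v ∈ {v : Edge 3 L → Fin 3 → ℝ | ‖linkEmbed L v‖ ≤ R}
      · rw [Set.indicator_of_mem hv, abs_one, one_mul]; exact hf1 v
      · rw [Set.indicator_of_notMem hv, abs_zero, zero_mul]; exact zero_le_one
  -- (1) the ring mass `≤ N̄(1+κ)·(A − B)`
  have h1 : ∫ x in cS L β \ I, cΘ L β x ^ 2 * cW L s M β x ∂orthoTransverse L ≤ Nbar * (1 + κ) * (A - B) := by
    rw [← integral_indicator (hSm.diff hIm), hAdef, hBdef, ← integral_sub (hind_i _) (hind_i _), ← integral_const_mul]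
    refine integral_mono ?_ (((hind_i _).sub (hind_i _)).const_mul _) fun x => ?_
    · exact hgi.indicator (hSm.diff hIm)
    · show (cS L β \ I).indicator (fun x => cΘ L β x ^ 2 * cW L s M β x) x ≤
        Nbar * (1 + κ) * ({v : Edge 3 L → Fin 3 → ℝ | ‖linkEmbed L v‖ ≤ rf}.indicator (fun _ => (1 : ℝ)) x * f x -
          {v : Edge 3 L → Fin 3 → ℝ | ‖linkEmbed L v‖ ≤ rf / 12}.indicator (fun _ => (1 : ℝ)) x * f x)
      by_cases hx : x ∈ cS L β \ I
      · have hxS := hx.1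
        have hxr : ‖linkEmbed L x‖ ≤ rf := (mem_cS hxS).2
        have hxi : ¬ ‖linkEmbed L x‖ ≤ rf / 12 := fun h => hx.2 ⟨hxS, h⟩
        rw [Set.indicator_of_mem hx, Set.indicator_of_mem (show x ∈ {v : Edge 3 L → Fin 3 → ℝ | ‖linkEmbed L v‖ ≤ rf} from hxr),
          Set.indicator_of_notMem (show x ∉ {v : Edge 3 L → Fin 3 → ℝ | ‖linkEmbed L v‖ ≤ rf / 12} from hxi), one_mul, zero_mul, sub_zero, hdens x hxS]
        exact mul_le_mul_of_nonneg_right (hNup x hxS) (hf0 x)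
      · rw [Set.indicator_of_notMem hx]
        refine mul_nonneg (by positivity) ?_
        by_cases h12 : x ∈ {v : Edge 3 L → Fin 3 → ℝ | ‖linkEmbed L v‖ ≤ rf / 12}
        · have hr : x ∈ {v : Edge 3 L → Fin 3 → ℝ | ‖linkEmbed L v‖ ≤ rf} := by
            show ‖linkEmbed L x‖ ≤ rf
            have h := (show ‖linkEmbed L x‖ ≤ rf / 12 from h12)
            have hrf0 : 0 ≤ rf := le_trans (norm_nonneg _) (h.trans (by linarith [norm_nonneg (linkEmbed L x)]))
            linarith
          rw [Set.indicator_of_mem h12, Set.indicator_of_mem hr, sub_self]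
        · rw [Set.indicator_of_notMem h12, zero_mul, sub_zero]; exact mul_nonneg (Set.indicator_nonneg (fun _ _ => zero_le_one) _) (hf0 x)
  -- (2) the total mass `≥ N̄(1−κ)·A`
  have hae : ∀ᵐ v ∂orthoTransverse L, v ∈ capBalancedSet L := by rw [ae_iff]; exact orthoTransverse_compl_capBalancedSet L
  have h2 : Nbar * (1 - κ) * A ≤ ∫ x, cΘ L β x ^ 2 * cW L s M β x ∂orthoTransverse L := by
    rw [hAdef, ← integral_const_mul]
    refine integral_mono_ae ((hind_i _).const_mul _) hgi (hae.mono fun x hcap => ?_)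
    show Nbar * (1 - κ) * ({v : Edge 3 L → Fin 3 → ℝ | ‖linkEmbed L v‖ ≤ rf}.indicator (fun _ => (1 : ℝ)) x * f x) ≤ cΘ L β x ^ 2 * cW L s M β x
    by_cases hxr : ‖linkEmbed L x‖ ≤ rf
    · have hxS : x ∈ cS L β := (mem_cS_iff β x).mpr ⟨hcap, hxr⟩
      rw [Set.indicator_of_mem (show x ∈ {v : Edge 3 L → Fin 3 → ℝ | ‖linkEmbed L v‖ ≤ rf} from hxr), one_mul, hdens x hxS]
      exact mul_le_mul_of_nonneg_right (hNlo x hxS) (hf0 x)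
    · rw [Set.indicator_of_notMem (show x ∉ {v : Edge 3 L → Fin 3 → ℝ | ‖linkEmbed L v‖ ≤ rf} from hxr), zero_mul, mul_zero]; exact hg0 x
  -- (3) algebra: `ring ≤ N̄(1+κ)(A − B) ≤ N̄(1+κ)(σ/3)B ≤ N̄(1+κ)(σ/3)A ≤ σ·N̄(1−κ)A ≤ σ·total`
  have hB0 : 0 ≤ B := integral_nonneg fun v => mul_nonneg (Set.indicator_nonneg (fun _ _ => zero_le_one) _) (hf0 v)
  have hBA : B ≤ A := by
    refine integral_mono (hind_i _) (hind_i _) fun v => mul_le_mul_of_nonneg_right ?_ (hf0 v)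
    refine Set.indicator_le_indicator_of_subset (fun v hv => ?_) (fun _ => zero_le_one) v
    show ‖linkEmbed L v‖ ≤ rf
    have h : ‖linkEmbed L v‖ ≤ rf / 12 := hv
    have : 0 ≤ rf := le_trans (norm_nonneg _) (h.trans (by linarith [norm_nonneg (linkEmbed L v)]))
    linarith
  have hA0 : 0 ≤ A := hB0.trans hBA
  calc ∫ x in cS L β \ I, cΘ L β x ^ 2 * cW L s M β x ∂orthoTransverse L ≤ Nbar * (1 + κ) * (A - B) := h1
    _ ≤ Nbar * (1 + κ) * (σ / 3 * A) := mul_le_mul_of_nonneg_left (by nlinarith) (by positivity)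
    _ = σ * (Nbar * A) * ((1 + κ) / 3) := by ring
    _ ≤ σ * (Nbar * A) * (1 - κ) := mul_le_mul_of_nonneg_left (by linarith) (mul_nonneg hσ.le (mul_nonneg hN0.le hA0))
    _ = σ * (Nbar * (1 - κ) * A) := by ring
    _ ≤ σ * ∫ x, cΘ L β x ^ 2 * cW L s M β x ∂orthoTransverse L := mul_le_mul_of_nonneg_left h2 hσ.le

end Summit.QuantumFields.YangMills.Theorems.FemtoTransferGap.TwoLattice.ConstTube

end
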